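import Summits.ResolutionOfSingularities.ResolutionOfSingularities.Theorems.FrobeniusClosingPatchingRelPerfectDepthWeightTwoBState
import Summits.ResolutionOfSingularities.ResolutionOfSingularities.Theorems.FrobeniusClosingPatchingRelPerfectDepthSNCExchange
import Literature.AlgebraicGeometry.Resolution.NormalCrossingWithHasSNC
import Literature.AlgebraicGeometry.Resolution.NormalCrossingsLocal
import Literature.AlgebraicGeometry.Resolution.RegularSubschemeLocallyIrreducible
import Literature.AlgebraicGeometry.Resolution.BlowupRestrictOpen
import Literature.AlgebraicGeometry.Resolution.RegularLocalRingsJacobian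
import Literature.AlgebraicGeometry.Resolution.StalkIdealGenerization
import Literature.AlgebraicGeometry.Resolution.StrictNormalCrossingsFlatDescent
import Literature.AlgebraicGeometry.Resolution.EmbeddedResolutionExcellentSurfacesSequence
import HarnessLib

/-!
# Crux `PatchingRelPerfect` (stmt-ResolutionOfSingularities-16161), chain W5.2 — TargetsF5J(R) T5-E «W₂B-maxweight»:
# the END — `EndStateJR`'s regularity and snc clauses from the CJS end clauses

[OURS · L1 W5.2 · TargetsF5J(R) T5-E] Fact-free; NOT statements of the manuscript under review. At the end of the CJS sequence
(`Z₁` regular, the reduced strict transform `𝓘(cl X₁)` regular, `X₁` transversal to `B₁`), the transport state `StateIn 𝔟' D' ℬ' 𝒟'` on a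
scheme `E₁ ≅ Z₁` (the isomorphism absorbs CJS steps with empty centre, which are not weighted steps) with `Supp D' = e⁻¹(cl X₁)` and
boundary supports inside `e⁻¹ B₁` yields `Scheme.IsRegular D'.subscheme` (the host IS `𝓘(e⁻¹ cl X₁)`, being reduced) and
`HasSNC (D' :: boundaryOf ℬ')`: pointwise, off the host by `SNCWithAt.cons_of_not_mem_support`; on the host by res-type-049's
`SNCWithAt.host_cons_transversal` from (i) `HasSNCWith (boundaryOf ℬ') D'` — res-type-019's P3 `hasSNCWith_of_isNormalCrossingWith`
applied ON `Z₁` to the boundary pushed along `e⁻¹` and pulled back (`hasSNCWith_comap_of_isNormalCrossingWith`), (ii) the host is a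
regular hypersurface, so of order one (`not_isRegularLocalRing_quotient_span_singleton_of_mem_sq`), (iii) no boundary sheaf through `x`
has its stalk inside the host's: it would put the generic point of its (irreducible) support on the host, against `StateIn.free`.

AI-written; AI review is weaker than expert review.

## References
* V. Cossart, U. Jannsen, S. Saito, LNM 2270 (2020), Thm. 1.4, Def. 4.1, p. 7. [CossartJannsenSaito2020]
* J. Kollár, *Lectures on Resolution of Singularities* (2007), 3.104 Step 2.1, Def. 3.25. [Kollar2007]
* H. Matsumura, *Commutative Ring Theory* (1987), Thm. 14.2. [Matsumura1987]
-/

-- `Summit.<Summit>.<Sub>.Theorems` with `Sub = Summit` (single-conjunct summit, D-0017)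
set_option linter.dupNamespace false

noncomputable section

open CategoryTheory CategoryTheory.Limits AlgebraicGeometry TopologicalSpace IsLocalRing
open Literature.AlgebraicGeometry.Resolution Scheme.IdealSheafData

namespace Summit.ResolutionOfSingularities.ResolutionOfSingularities.Theorems

universe u

namespace WeightTwoB

open DepthSNC

/-! ## Transport tools along an isomorphism `e : E' ≅ Z'` -/

section Iso

variable {E' Z' : Scheme.{u}} (e : E' ≅ Z')

/-- `(K.comap e.inv).comap e.hom = K`. [folklore] -/
theorem comap_inv_comap_hom (K : E'.IdealSheafData) : (K.comap e.inv).comap e.hom = K := by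
  rw [← Scheme.IdealSheafData.comap_comp, e.hom_inv_id, Scheme.IdealSheafData.comap_id]

/-- `e.hom (e.inv y) = y`. [folklore] -/
theorem hom_inv_apply (y : Z') : e.hom (e.inv y) = y := by
  rw [← Scheme.Hom.comp_apply, e.inv_hom_id]; rfl

/-- `e.inv (e.hom x) = x`. [folklore] -/
theorem inv_hom_apply (x : E') : e.inv (e.hom x) = x := by
  rw [← Scheme.Hom.comp_apply, e.hom_inv_id]; rfl

/-- **PUSH–P3–PULL**: a simple-normal-crossings family on `E'` whose supports lie over `B ⊆ Z'` has simple normal crossings with the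
pull-back of every reduced centre `C` on `Z'` that is n.c. with `B` (res-type-019's P3 on `Z'`, transported along `e`).
[cite: CossartJannsenSaito2020, Def. 4.1] [cite: BierstoneGrigorievMilmanWlodarczyk2011, Def. 3.1.3 (2)] -/
theorem hasSNCWith_comap_of_isNormalCrossingWith [IsLocallyNoetherian E'] [IsLocallyNoetherian Z']
    {L : List E'.IdealSheafData} (hL : HasSNC L) {B : Set Z'} (hLB : ∀ K ∈ L, (K.support : Set E') ⊆ e.hom ⁻¹' B)
    {C : Z'.IdealSheafData} (hC : C = vanishingIdeal C.support) (hnc : IsNormalCrossingWith Z' (C.support : Set Z') B) :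
    HasSNCWith L (C.comap e.hom) := by
  -- push the family to `Z'`
  have h1 : HasSNC (L.map (·.comap e.inv)) := by
    have h := hL.comap_of_isOpenImmersion e.inv
    rwa [Scheme.IdealSheafData.comap_top] at h
  have h2 : (⋃ K ∈ L.map (·.comap e.inv), (K.support : Set Z')) ⊆ B := by
    intro y hy
    simp only [List.mem_map, Set.mem_iUnion, exists_prop] at hy
    obtain ⟨K', ⟨K, hK, rfl⟩, hyK⟩ := hy
    rw [support_comap, Closeds.coe_preimage, Set.mem_preimage] at hyK
    have h := hLB K hK hyK
    rwa [Set.mem_preimage, hom_inv_apply] at h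
  have h3 : HasSNCWith (L.map (·.comap e.inv)) C := hasSNCWith_of_isNormalCrossingWith h1 h2 hC hnc
  -- pull back to `E'`
  have h4 := h3.comap_of_isOpenImmersion e.hom
  have hlist : (L.map (·.comap e.inv)).map (·.comap e.hom) = L := by
    rw [List.map_map]
    exact (List.map_congr_left fun K _ => comap_inv_comap_hom e K).trans (List.map_id _)
  rwa [hlist] at h4

/-- The ideal of a closed subset pulls back along `e` to the ideal of its preimage. [folklore] -/
theorem comap_hom_vanishingIdeal (T : Closeds Z') :
    (vanishingIdeal T).comap e.hom = vanishingIdeal ⟨e.hom ⁻¹' T, T.isClosed.preimage e.hom.continuous⟩ :=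
  comap_vanishingIdeal_of_isOpenImmersion e.hom T

end Iso

/-! ## A regular hypersurface is an snc family of one member -/

/-- **A regular effective Cartier divisor has order one**: on a regular scheme, `[D]` is snc at every point when `V(D)` is a
regular closed subscheme (Matsumura 14.2: `𝒪/(g)` regular forces `g ∉ 𝔪²`). [cite: Matsumura1987, Thm. 14.2] -/
theorem sncWithAt_singleton_of_isRegular_subscheme {W : Scheme.{u}} [IsLocallyNoetherian W] (hW : Scheme.IsRegular W)
    {D : W.IdealSheafData} (hD : IsEffectiveCartier D) (hreg : Scheme.IsRegular D.subscheme) (x : W) :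
    SNCWithAt [D] ⊤ x := by
  by_cases hx : x ∈ D.support
  · haveI := hW x
    obtain ⟨g, hg0, hg⟩ := hD.exists_stalkIdeal_eq_span x
    have hgm : g ∈ maximalIdeal (W.presheaf.stalk x) := by
      have h := (mem_support_iff_stalkIdeal_le D x).mp hx
      rw [hg, Ideal.span_singleton_le_iff_mem] at h
      exact h
    have hg2 : g ∉ maximalIdeal (W.presheaf.stalk x) ^ 2 := fun h2 =>
      not_isRegularLocalRing_quotient_span_singleton_of_mem_sq (nonZeroDivisors.ne_zero hg0) h2
        (hg ▸ isRegularLocalRing_stalk_quotient_stalkIdeal hreg hx)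
    exact SNCWithAt.singleton_of_span_singleton (hW x) hg hgm hg2
  · exact ((hasSNCWith_nil_of_isRegular hW (isRegular_subscheme_top (X := W))).sncWithAt x).cons_of_not_mem_support hx

/-! ## The END -/

section End

variable {E₁ Z₁ : Scheme.{u}} [IsLocallyNoetherian E₁] [IsLocallyNoetherian Z₁]
  {𝔟' D' : E₁.IdealSheafData} {ℬ' 𝒟' : List (E₁.IdealSheafData × ℕ)}

/-- **No boundary sheaf has its stalk inside the host's at a common point**: it would put the generic point of its irreducible
support on the host (`StateIn.free`). [cite: Kollar2007, 3.30.2] -/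
theorem StateIn.not_stalkIdeal_le_host (S : StateIn 𝔟' D' ℬ' 𝒟') {p : E₁.IdealSheafData × ℕ} (hp : p ∈ ℬ') {x : E₁} (hxB : x ∈ p.1.support)
    (hxD : x ∈ D'.support) : ¬ stalkIdeal p.1 x ≤ stalkIdeal D' x := by
  haveI := S.regW x
  haveI := isDomain_of_isRegularLocalRing (E₁.presheaf.stalk x)
  intro hle
  obtain ⟨ξ, hξ⟩ := QuasiSober.sober (S.irred p hp) p.1.support.isClosed
  have hξx : ξ ⤳ x := hξ.specializes hxB
  have hBmem : p.1 ∈ boundaryOf ℬ' := List.mem_map.mpr ⟨p, hp, rfl⟩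
  -- the stalk of the member at `x` is the prime of `ξ`
  have hBx : stalkIdeal p.1 x = primeOfSpecializes hξx := by
    have hcl : p.1.support = ⟨closure {ξ}, isClosed_closure⟩ := Closeds.ext hξ.symm
    rw [S.eq_vanishingIdeal_of_mem hBmem, hcl, stalkIdeal_vanishingIdeal_closure hξx]
  -- generators: `B_x = (u)` with `u` prime, `D'_x = (g)` with `g ∈ 𝔪`
  obtain ⟨u, hu0, hu⟩ := (S.isEffectiveCartier_of_mem hBmem).exists_stalkIdeal_eq_span x
  obtain ⟨g, -, hg⟩ := S.hostCartier.exists_stalkIdeal_eq_span x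
  have hgm : g ∈ maximalIdeal (E₁.presheaf.stalk x) := by
    have h := (mem_support_iff_stalkIdeal_le D' x).mp hxD
    rw [hg, Ideal.span_singleton_le_iff_mem] at h
    exact h
  haveI hprime : (primeOfSpecializes hξx).IsPrime := Ideal.IsPrime.comap _
  have huprime : Prime u := by
    rw [← Ideal.span_singleton_prime (nonZeroDivisors.ne_zero hu0), ← hu, hBx]; exact hprime
  -- `(u) ≤ (g)`: `u = g c`; `u` prime and `g` a non-unit force `u ∣ g`, so `(g) ≤ (u)` and `ξ ∈ Supp D'`
  rw [hu, hg, Ideal.span_singleton_le_span_singleton] at hle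
  obtain ⟨c, hc⟩ := hle
  have hug : u ∣ g := by
    rcases huprime.dvd_or_dvd (show u ∣ g * c from ⟨1, by rw [mul_one, hc]⟩) with h | h
    · exact h
    · exfalso
      obtain ⟨d, hd⟩ := h
      have h1 : u * (1 - g * d) = 0 := by linear_combination hc + g * hd
      rcases mul_eq_zero.mp h1 with h0 | h0
      · exact nonZeroDivisors.ne_zero hu0 h0
      · have hunit : IsUnit g := isUnit_iff_exists_inv.mpr ⟨d, by linear_combination -h0⟩
        exact (maximalIdeal.isMaximal _).ne_top (Ideal.eq_top_of_isUnit_mem _ hgm hunit)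
  have hDξ : stalkIdeal D' x ≤ primeOfSpecializes hξx := by
    rw [← hBx, hu, hg]; exact Ideal.span_singleton_le_span_singleton.mpr hug
  have hξD : ξ ∈ D'.support := (mem_support_iff_stalkIdeal_le_primeOfSpecializes hξx D').mpr hDξ
  refine S.free p hp ?_
  rw [← hξ]
  exact closure_minimal (Set.singleton_subset_iff.mpr hξD) D'.support.isClosed


/-- **THE END**: from the CJS end clauses on `Z₁` (the reduced strict transform `𝓘(cl X₁)` regular, `X₁` transversal to `B₁`),
read through `e : E₁ ≅ Z₁`, the transport state with `Supp D' = e⁻¹(cl X₁)` and boundary supports inside `e⁻¹ B₁` satisfies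
`IsRegular D'.subscheme ∧ HasSNC (D' :: boundaryOf ℬ')`. [cite: CossartJannsenSaito2020, Thm. 1.4, p. 7]
[cite: Kollar2007, 3.104 Step 2.1] -/
theorem StateIn.endClauses (S : StateIn 𝔟' D' ℬ' 𝒟') (e : E₁ ≅ Z₁) {X₁ B₁ : Set Z₁} (hX₁c : IsClosed X₁)
    (hX₁ : Scheme.IsRegular (vanishingIdeal ⟨closure X₁, isClosed_closure⟩).subscheme) (htr : IsTransversalWith Z₁ X₁ B₁)
    (hsupp : (D'.support : Set E₁) = e.hom ⁻¹' closure X₁) (hbd : ∀ p ∈ ℬ', (p.1.support : Set E₁) ⊆ e.hom ⁻¹' B₁) :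
    Scheme.IsRegular D'.subscheme ∧ HasSNC (D' :: boundaryOf ℬ') := by
  set T : Closeds Z₁ := ⟨closure X₁, isClosed_closure⟩ with hT
  -- the host IS the pulled-back reduced ideal of `cl X₁`
  have hD : D' = (vanishingIdeal T).comap e.hom := by
    rw [comap_hom_vanishingIdeal, S.hostRad]
    congr 1
    exact Closeds.ext hsupp
  have hreg : Scheme.IsRegular D'.subscheme := by
    rw [hD]; exact isRegular_subscheme_comap_of_isOpenImmersion e.hom _ hX₁
  refine ⟨hreg, hasSNCWith_of_forall_sncWithAt fun x => ?_⟩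
  by_cases hx : x ∈ D'.support
  swap
  · exact (S.sncB.sncWithAt x).cons_of_not_mem_support hx
  -- on the host: boundary snc WITH the host (P3 on `Z₁`), the host of order one, members transversal
  have hTsupp : ((vanishingIdeal T).support : Set Z₁) = closure X₁ := Scheme.IdealSheafData.coe_support_vanishingIdeal T
  have hnc : IsNormalCrossingWith Z₁ ((vanishingIdeal T).support : Set Z₁) B₁ := by
    rw [hTsupp, hX₁c.closure_eq]; exact htr.isNormalCrossingWith
  have hℬ : HasSNCWith (boundaryOf ℬ') D' := by
    rw [hD]
    refine hasSNCWith_comap_of_isNormalCrossingWith e S.sncB (fun K hK => ?_) ?_ hnc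
    · obtain ⟨p, hp, rfl⟩ := List.mem_map.mp hK
      exact hbd p hp
    · have hs : (vanishingIdeal T).support = T := Closeds.ext (Scheme.IdealSheafData.coe_support_vanishingIdeal T)
      rw [hs]
  have hhost : SNCWithAt [D'] ⊤ x := sncWithAt_singleton_of_isRegular_subscheme S.regW S.hostCartier hreg x
  refine (SNCWithAt.host_cons_transversal (hℬ.sncWithAt x) hhost le_rfl fun B hB hxB => ⟨hB, ?_⟩).top
  obtain ⟨p, hp, rfl⟩ := List.mem_map.mp hB
  exact S.not_stalkIdeal_le_host hp hxB hx

end End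

end WeightTwoB

end Summit.ResolutionOfSingularities.ResolutionOfSingularities.Theorems

end
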